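import Mathlib
import HarnessLib
import Summits.HubbardSuperconductivity.HubbardSuperconductivity.Theorems.KLProgrammeKLRegimeTwoPointLimitCooperResummation
import Summits.HubbardSuperconductivity.HubbardSuperconductivity.Theorems.KLProgrammeCooperChannelRiccatiFlowDefs

/-!
# Route `KLProgramme`, crux K3 (stmt-HubbardSuperconductivity-19937), child 1 `KLRegimeBetaSplit` — the Cooper resummation as a
# FLOW in the weighted max-entry norm: structure (`= cascadeStep` of the s-wave value `+ O(δ)`), Lipschitz continuity
# (constant `36`, uniform in the accumulated mass) and the composition law (cell gate-hubbard-kl, seat p1 = C1 lead, g5)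

Sequel to `KLProgrammeKLRegimeTwoPointLimitCooperResummation` (`klcr_resummed_entry_le`: the resummed array is entrywise bounded).
For a finite carrier `S`, weights `w ≥ 0` of total mass `W = Σ w` (the accumulated particle–particle bubble mass sits in `w`), an
array `𝒞 = u·J + 𝒟` (`J` all-ones, `u ≥ 0` the running s-wave value, `|𝒟| ≤ δ` entrywise) and `W·δ ≤ 1/3`, write
`F_w(𝒞) := (1 + 𝒞·diag w)⁻¹·𝒞` for the exactly resummed ladder.  This file and its sequel `…CooperResummationLipschitz`
prove the three facts child 1's induction on the amended Cooper datum (B1-v2) `PairArrayAt` (module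
`KLProgrammeKLRegimeSplitPredicatesV2`) iterates (STRUCTURE here; LIPSCHITZ and COMPOSITION in the sequel):

* STRUCTURE (`klcrf_structure`): `F_w(u·J + 𝒟) = cascadeStep W u · J + 𝒟''` with `|𝒟''| ≤ 12·δ` entrywise — the s-wave value flows
  by C2's scalar cascade `x ↦ x/(1 + W x)` EXACTLY (`CooperChannelRiccatiFlow.cascadeStep`), the rest stays second order, uniformly
  in `u·W` (Sherman–Morrison; `u ≥ 0` gives the denominator `Re d ≥ 1 + uW/2`);
* LIPSCHITZ (`klcrf_lipschitz`): `|F_w(u·J + 𝒟₁) − F_w(u·J + 𝒟₂)| ≤ 36·max|𝒟₁ − 𝒟₂|` entrywise, via the resolvent identity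
  `F(X₁) − F(X₂) = (1 + X₁ diag w)⁻¹ (X₁ − X₂) (1 − diag w · F(X₂))` (`klcrf_resolvent_identity`) and the row / weighted-column sums
  `≤ 6` of the two outer factors — a source `S_j` injected at scale `j` therefore moves the resummed array at every later scale by at
  most `36·max|S_j|`, with NO amplification by the large factor `1 + u·W ≍ c/U` (the forward ladder squashes the s-wave direction);
* COMPOSITION (`klcrf_compose`): `F_{w₂}(F_{w₁}(X)) = F_{w₁+w₂}(X)` whenever the two resummations exist (Möbius maps compose
  additively in the mass: integrating the shells one at a time or all at once is the same ladder).

So child 1's bookkeeping for the leaf reads: `𝒞_n = F_{𝔅_n}(𝒞₀) + Σ_{j≤n} [F_{𝔅_{(j,n]}}(Y_j + S_j + R_j) − F_{𝔅_{(j,n]}}(Y_j)]` with every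
bracket `≤ 36·max|S_j + R_j|` and the first term `= cascadeStep(B̄_n) U · J + O(U²)` — no compounding of constants across `c/U²` scales.
Pure finite-dimensional linear algebra; nothing about the model is asserted.  References: HOME/STATUS 2026-08-26T09:21:49Z / 11:2xZ (p1);
J. Sherman, W. J. Morrison (1950); HOME/DECOMP.md App. E (E.4).
-/

noncomputable section

namespace Summit.HubbardSuperconductivity.HubbardSuperconductivity.Theorems.KLProgrammeCooperResummation

set_option linter.dupNamespace false -- summit = problem name (single-conjunct summit), D-0017

open scoped Matrix.Norms.Operator
open Matrix Finset
open Summit.HubbardSuperconductivity.HubbardSuperconductivity.Theorems.CooperChannelRiccatiFlow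

variable {S : Type*} [Fintype S] [DecidableEq S] [Nonempty S]

/-- **Neumann, sharp form.**  If `‖X‖ ≤ 1/3` then `1 + X` has a two-sided inverse `N` with `‖N‖ ≤ 3/2` and `‖N - 1‖ ≤ (3/2)‖X‖`. -/
theorem klcrf_neumann_sharp (X : Matrix S S ℂ) (hX : ‖X‖ ≤ 1 / 3) :
    ∃ N : Matrix S S ℂ, (1 + X) * N = 1 ∧ N * (1 + X) = 1 ∧ ‖N‖ ≤ 3 / 2 ∧ ‖N - 1‖ ≤ 3 / 2 * ‖X‖ := by
  obtain ⟨N, h1, h2, hN, -⟩ := klcr_neumann X hX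
  refine ⟨N, h1, h2, hN, ?_⟩
  have hid : N - 1 = -(X * N) := by
    have h1' : N + X * N = 1 := by rw [add_mul, one_mul] at h1; exact h1
    calc N - 1 = N - (N + X * N) := by rw [h1']
      _ = -(X * N) := by abel
  rw [hid, norm_neg]
  calc ‖X * N‖ ≤ ‖X‖ * ‖N‖ := norm_mul_le _ _
    _ ≤ ‖X‖ * (3 / 2) := mul_le_mul_of_nonneg_left hN (norm_nonneg _)
    _ = 3 / 2 * ‖X‖ := by ring

omit [DecidableEq S] [Nonempty S] in
/-- Row sums of an outer product `|a⟩⟨w|`: `Σ_t |a_s w_t| = |a_s|·Σ|w_t|`. -/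
theorem klcrf_row_sum_vecMulVec (a w : S → ℂ) (s : S) :
    ∑ t, ‖Matrix.vecMulVec a w s t‖ = ‖a s‖ * ∑ t, ‖w t‖ := by
  simp_rw [Matrix.vecMulVec_apply, norm_mul, ← Finset.mul_sum]

set_option maxHeartbeats 400000 in
/-- **The Sherman–Morrison STRUCTURE of the resummation (child 1's one-step / all-step form).**  For weights `w ≥ 0` with
`W = Σ w`, `u ≥ 0`, `|𝒟| ≤ δ` entrywise and `W·δ ≤ 1/3`: `T = 1 + (u·J + 𝒟)·diag w` is invertible, every ROW sum of `T⁻¹` is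
`≤ 6`, and the resummed array is the scalar cascade of the s-wave value plus a second-order rest:
`|(T⁻¹·(u·J + 𝒟))(s,t) − cascadeStep W u| ≤ 12·δ` for all `s, t` — uniformly in `u·W`. -/
theorem klcrf_structure (w : S → ℝ) (hw : ∀ s, 0 ≤ w s) {u δ : ℝ} (hu : 0 ≤ u) (hδ : 0 ≤ δ)
    (𝒟 : Matrix S S ℂ) (h𝒟 : ∀ s t, ‖𝒟 s t‖ ≤ δ) (hθ : (∑ s, w s) * δ ≤ 1 / 3) :
    IsUnit (1 + (Matrix.of (fun _ _ : S => (u : ℂ)) + 𝒟) * Matrix.diagonal (fun s => (w s : ℂ))) ∧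
    (∀ s, ∑ p, ‖((1 + (Matrix.of (fun _ _ : S => (u : ℂ)) + 𝒟) * Matrix.diagonal (fun s => (w s : ℂ)))⁻¹) s p‖ ≤ 6) ∧
    ∀ s t : S,
      ‖((1 + (Matrix.of (fun _ _ : S => (u : ℂ)) + 𝒟) * Matrix.diagonal (fun s => (w s : ℂ)))⁻¹ *
            (Matrix.of (fun _ _ : S => (u : ℂ)) + 𝒟)) s t - (cascadeStep (∑ s, w s) u : ℝ)‖ ≤ 12 * δ := by
  -- notation
  set W : ℝ := ∑ s, w s with hW_def
  have hW : 0 ≤ W := sum_nonneg fun s _ => hw s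
  set wC : S → ℂ := fun s => (w s : ℂ) with hwC_def
  set one : S → ℂ := fun _ => (1 : ℂ) with hone_def
  set Dw : Matrix S S ℂ := Matrix.diagonal wC with hDw_def
  set J : Matrix S S ℂ := Matrix.of (fun _ _ : S => (u : ℂ)) with hJ_def
  set 𝒞 : Matrix S S ℂ := J + 𝒟 with h𝒞_def
  set X : Matrix S S ℂ := 𝒟 * Dw with hX_def
  have hθ' : W * δ ≤ 1 / 3 := hθ
  have hwsum : ∑ i, ‖wC i‖ = W := by
    rw [hW_def]; exact sum_congr rfl fun i _ => by rw [hwC_def]; simp [abs_of_nonneg (hw i)]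
  -- Neumann for `X = 𝒟·diag w` (mass absorbed: `B = 1`)
  have hXn' : ‖X‖ ≤ W * δ := by
    have := klcr_norm_smul_mul_diagonal_le w hw (zero_le_one) hδ 𝒟 h𝒟
    rw [Complex.ofReal_one, one_smul, one_mul] at this
    exact this
  have hXn : ‖X‖ ≤ 1 / 3 := hXn'.trans hθ'
  obtain ⟨N, hN1, hN2, hNn, hNm1⟩ := klcrf_neumann_sharp X hXn
  have hNm1' : ‖N - 1‖ ≤ 3 / 2 * (W * δ) := hNm1.trans (by nlinarith [norm_nonneg X])
  have hNm1'' : ‖N - 1‖ ≤ 1 / 2 := hNm1.trans (by nlinarith [norm_nonneg X])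
  -- `J * Dw = u |𝟙⟩⟨w|` and `T = (1 + X) + u |𝟙⟩⟨w|`
  have hJDw : J * Dw = (u : ℂ) • Matrix.vecMulVec one wC := by
    ext s t
    simp [hJ_def, hDw_def, Matrix.mul_diagonal, Matrix.vecMulVec_apply, hone_def]
  set T : Matrix S S ℂ := 1 + 𝒞 * Dw with hT_def
  have hT : T = (1 + X) + (u : ℂ) • Matrix.vecMulVec one wC := by
    simp only [hT_def, h𝒞_def, hX_def, add_mul, hJDw]
    abel
  -- Sherman–Morrison data
  set m : S → ℂ := N *ᵥ one with hm_def
  have hm1 : ∀ s, ‖m s - 1‖ ≤ 3 / 2 * (W * δ) := by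
    intro s
    have hsplit : m s - 1 = ((N - 1) *ᵥ one) s := by
      simp only [hm_def, Matrix.sub_mulVec, Matrix.one_mulVec, Pi.sub_apply, hone_def]
    rw [hsplit]
    exact (klcr_mulVec_entry_le (N - 1) one zero_le_one (fun k => by simp [hone_def]) s).trans (by linarith)
  have hm1' : ∀ s, ‖m s - 1‖ ≤ 1 / 2 := fun s => (hm1 s).trans (by nlinarith)
  have hm_bound : ∀ s, ‖m s‖ ≤ 3 / 2 := by
    intro s
    calc ‖m s‖ = ‖(m s - 1) + 1‖ := by rw [sub_add_cancel]
      _ ≤ ‖m s - 1‖ + ‖(1 : ℂ)‖ := norm_add_le _ _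
      _ ≤ 3 / 2 := by rw [norm_one]; linarith [hm1' s]
  have hm_re : ∀ s, 1 / 2 ≤ (m s).re := by
    intro s
    have h := (Complex.abs_re_le_norm (m s - 1)).trans (hm1' s)
    rw [Complex.sub_re, Complex.one_re, abs_le] at h
    linarith [h.1]
  set a : S → ℂ := (u : ℂ) • m with ha_def
  have ha_bound : ∀ s, ‖a s‖ ≤ u * (3 / 2) := by
    intro s
    simp only [ha_def, Pi.smul_apply, smul_eq_mul, norm_mul, Complex.norm_real, Real.norm_eq_abs, abs_of_nonneg hu]
    exact mul_le_mul_of_nonneg_left (hm_bound s) hu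
  set d : ℂ := 1 + wC ⬝ᵥ a with hd_def
  -- `d = 1 + uW + u⟨w, m - 1⟩`
  have hd_split : d = 1 + (u : ℂ) * W + (u : ℂ) * ∑ s, wC s * (m s - 1) := by
    simp only [hd_def, dotProduct, ha_def, Pi.smul_apply, smul_eq_mul, hW_def, Complex.ofReal_sum, hwC_def]
    rw [Finset.mul_sum, Finset.mul_sum, add_assoc, ← Finset.sum_add_distrib]
    congr 1
    exact sum_congr rfl fun s _ => by ring
  have hwm : ‖∑ s, wC s * (m s - 1)‖ ≤ W * (3 / 2 * (W * δ)) := by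
    calc ‖∑ s, wC s * (m s - 1)‖ ≤ ∑ s, ‖wC s * (m s - 1)‖ := norm_sum_le _ _
      _ ≤ ∑ s, w s * (3 / 2 * (W * δ)) := sum_le_sum fun s _ => by
          rw [norm_mul, hwC_def]
          simp only [Complex.norm_real, Real.norm_eq_abs, abs_of_nonneg (hw s)]
          exact mul_le_mul_of_nonneg_left (hm1 s) (hw s)
      _ = W * (3 / 2 * (W * δ)) := by rw [← Finset.sum_mul]
  have hd_re : 1 + u * W / 2 ≤ d.re := by
    have hsum : (wC ⬝ᵥ a).re = ∑ s, u * (w s * (m s).re) := by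
      simp only [dotProduct, Complex.re_sum, hwC_def, ha_def, Pi.smul_apply, smul_eq_mul]
      refine sum_congr rfl fun s _ => ?_
      have : ((w s : ℂ) * ((u : ℂ) * m s)).re = u * (w s * (m s).re) := by
        simp [Complex.mul_re, Complex.ofReal_re, Complex.ofReal_im]; ring
      exact this
    rw [hd_def, Complex.add_re, Complex.one_re, hsum, ← Finset.mul_sum]
    have : W / 2 ≤ ∑ s, w s * (m s).re := by
      rw [hW_def, Finset.sum_div]
      exact sum_le_sum fun s _ => by have := mul_le_mul_of_nonneg_left (hm_re s) (hw s); linarith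
    nlinarith
  have hd_norm : 1 + u * W / 2 ≤ ‖d‖ := hd_re.trans (Complex.re_le_norm d)
  have hd_pos : 0 < ‖d‖ := lt_of_lt_of_le (by nlinarith [mul_nonneg hu hW]) hd_norm
  have hd_ne : d ≠ 0 := norm_pos_iff.mp hd_pos
  -- the right inverse `R = (1 - d⁻¹ |a⟩⟨w|) N`
  set V : Matrix S S ℂ := Matrix.vecMulVec a wC with hV_def
  set R : Matrix S S ℂ := (1 - d⁻¹ • V) * N with hR_def
  have hNa : (1 + X) *ᵥ a = (u : ℂ) • one := by
    simp only [ha_def, Matrix.mulVec_smul, hm_def, Matrix.mulVec_mulVec, hN1, Matrix.one_mulVec]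
  have hfac : T = (1 + X) * (1 + V) := by
    rw [mul_add, mul_one, hV_def, Matrix.mul_vecMulVec, hNa, hT]
    congr 1
    ext s t
    simp [Matrix.vecMulVec_apply, hone_def]
  have hVV : V * V = (wC ⬝ᵥ a) • V := by
    rw [hV_def, Matrix.vecMulVec_mul_vecMulVec, Matrix.vecMulVec_smul]
  have hSM : (1 + V) * (1 - d⁻¹ • V) = 1 := by
    calc (1 + V) * (1 - d⁻¹ • V) = (1 + V) - d⁻¹ • ((1 + V) * V) := by rw [mul_sub, mul_one, mul_smul_comm]
      _ = (1 + V) - d⁻¹ • ((1 + wC ⬝ᵥ a) • V) := by rw [add_mul, one_mul, hVV, add_smul, one_smul]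
      _ = (1 + V) - (d⁻¹ * d) • V := by rw [smul_smul, hd_def]
      _ = 1 := by rw [inv_mul_cancel₀ hd_ne, one_smul, add_sub_cancel_right]
  have hTR : T * R = 1 := by
    rw [hfac, hR_def, ← mul_assoc, mul_assoc (1 + X), hSM, mul_one, hN1]
  have hTunit : IsUnit T := by
    rw [Matrix.isUnit_iff_isUnit_det]
    exact Matrix.isUnit_det_of_right_inverse hTR
  have hTinv : T⁻¹ = R := Matrix.inv_eq_right_inv hTR
  -- row sums of `N`
  have hNrow : ∀ s, ∑ p, ‖N s p‖ ≤ 3 / 2 := fun s => (klcr_row_sum_le_norm N s).trans hNn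
  refine ⟨hTunit, ?_, ?_⟩
  · -- row sums of `T⁻¹ = N - d⁻¹ |a⟩ (⟨w| N)`
    intro s
    have hRs : ∀ p, R s p = N s p - d⁻¹ * (a s * (wC ᵥ* N) p) := by
      intro p
      simp only [hR_def, sub_mul, one_mul, Matrix.smul_mul, hV_def, Matrix.vecMulVec_mul, Matrix.sub_apply,
        Matrix.smul_apply, Matrix.vecMulVec_apply, smul_eq_mul]
    have hwN : ∀ p, ‖(wC ᵥ* N) p‖ ≤ ∑ q, w q * ‖N q p‖ := by
      intro p
      rw [Matrix.vecMul, dotProduct]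
      refine (norm_sum_le _ _).trans (le_of_eq (sum_congr rfl fun q _ => ?_))
      rw [norm_mul, hwC_def]; simp [abs_of_nonneg (hw q)]
    rw [hTinv]
    calc ∑ p, ‖R s p‖ = ∑ p, ‖N s p - d⁻¹ * (a s * (wC ᵥ* N) p)‖ := sum_congr rfl fun p _ => by rw [hRs p]
      _ ≤ ∑ p, (‖N s p‖ + ‖d‖⁻¹ * (‖a s‖ * ‖(wC ᵥ* N) p‖)) := sum_le_sum fun p _ => by
          refine (norm_sub_le _ _).trans (add_le_add le_rfl ?_)
          rw [norm_mul, norm_mul, norm_inv]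
      _ = ∑ p, ‖N s p‖ + ‖d‖⁻¹ * ‖a s‖ * ∑ p, ‖(wC ᵥ* N) p‖ := by
          rw [sum_add_distrib, Finset.mul_sum]; congr 1; exact sum_congr rfl fun p _ => by ring
      _ ≤ 3 / 2 + ‖d‖⁻¹ * ‖a s‖ * ∑ p, ∑ q, w q * ‖N q p‖ := by
          refine add_le_add (hNrow s) (mul_le_mul_of_nonneg_left (sum_le_sum fun p _ => hwN p) ?_)
          exact mul_nonneg (inv_nonneg.mpr (norm_nonneg _)) (norm_nonneg _)
      _ = 3 / 2 + ‖d‖⁻¹ * ‖a s‖ * ∑ q, w q * ∑ p, ‖N q p‖ := by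
          congr 1; congr 1; rw [Finset.sum_comm]; exact sum_congr rfl fun q _ => by rw [Finset.mul_sum]
      _ ≤ 3 / 2 + ‖d‖⁻¹ * ‖a s‖ * (W * (3 / 2)) := by
          refine add_le_add le_rfl (mul_le_mul_of_nonneg_left ?_ ?_)
          · calc ∑ q, w q * ∑ p, ‖N q p‖ ≤ ∑ q, w q * (3 / 2) :=
                  sum_le_sum fun q _ => mul_le_mul_of_nonneg_left (hNrow q) (hw q)
              _ = W * (3 / 2) := by rw [← Finset.sum_mul]
          · exact mul_nonneg (inv_nonneg.mpr (norm_nonneg _)) (norm_nonneg _)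
      _ ≤ 3 / 2 + 9 / 2 := by
          refine add_le_add le_rfl ?_
          have hkey : ‖d‖⁻¹ * (u * W) ≤ 2 := by
            rw [inv_mul_le_iff₀ hd_pos]; nlinarith [hd_norm, mul_nonneg hu hW]
          calc ‖d‖⁻¹ * ‖a s‖ * (W * (3 / 2)) ≤ ‖d‖⁻¹ * (u * (3 / 2)) * (W * (3 / 2)) := by
                gcongr; exact ha_bound s
            _ = (‖d‖⁻¹ * (u * W)) * (9 / 4) := by ring
            _ ≤ 2 * (9 / 4) := by gcongr
            _ = 9 / 2 := by norm_num
      _ = 6 := by norm_num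
  · -- structure: `T⁻¹ 𝒞 = (u/d) |m⟩⟨𝟙| + (N 𝒟 - d⁻¹ |a⟩⟨w| N 𝒟)`
    intro s t
    have hNC : T⁻¹ * 𝒞 = N * 𝒞 - d⁻¹ • Matrix.vecMulVec a (wC ᵥ* (N * 𝒞)) := by
      rw [hTinv, hR_def, mul_assoc, sub_mul, one_mul, Matrix.smul_mul, hV_def, Matrix.vecMulVec_mul]
    -- `N * J = u |m⟩⟨𝟙|`, `⟨w| (N J) = u ⟨w,m⟩ ⟨𝟙|`
    have hNJ : ∀ p q, (N * J) p q = (u : ℂ) * m p := by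
      intro p q
      simp only [Matrix.mul_apply, hJ_def, Matrix.of_apply, hm_def, Matrix.mulVec, dotProduct, hone_def, mul_one]
      rw [← Finset.sum_mul, mul_comm]
    have hwNJ : ∀ q, (wC ᵥ* (N * J)) q = (u : ℂ) * (wC ⬝ᵥ m) := by
      intro q
      simp only [Matrix.vecMul, dotProduct, hNJ]
      rw [Finset.mul_sum]
      exact sum_congr rfl fun p _ => by ring
    have hdm : d = 1 + (u : ℂ) * (wC ⬝ᵥ m) := by
      simp only [hd_def, dotProduct, ha_def, Pi.smul_apply, smul_eq_mul, Finset.mul_sum]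
      congr 1; exact sum_congr rfl fun p _ => by ring
    -- the entry, split into the s-wave part and the rest
    have hentry : (T⁻¹ * 𝒞) s t = (u : ℂ) / d * m s +
        ((N * 𝒟) s t - d⁻¹ * (a s * (wC ᵥ* (N * 𝒟)) t)) := by
      rw [hNC]
      simp only [Matrix.sub_apply, Matrix.smul_apply, Matrix.vecMulVec_apply, smul_eq_mul, h𝒞_def, mul_add,
        Matrix.add_apply, Matrix.vecMul_add, Pi.add_apply, hNJ, hwNJ]
      simp only [ha_def, Pi.smul_apply, smul_eq_mul]
      have hd1 : d⁻¹ * ((u : ℂ) * (wC ⬝ᵥ m)) = 1 - d⁻¹ := by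
        have : (u : ℂ) * (wC ⬝ᵥ m) = d - 1 := by rw [hdm]; ring
        rw [this, mul_sub, inv_mul_cancel₀ hd_ne, mul_one]
      have key : (u : ℂ) * m s - d⁻¹ * ((u : ℂ) * m s * ((u : ℂ) * (wC ⬝ᵥ m))) = (u : ℂ) / d * m s := by
        have : d⁻¹ * ((u : ℂ) * m s * ((u : ℂ) * (wC ⬝ᵥ m))) = (u : ℂ) * m s * (d⁻¹ * ((u : ℂ) * (wC ⬝ᵥ m))) := by ring
        rw [this, hd1]
        field_simp
        ring
      rw [← key]
      ring
    -- bounds on the pieces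
    have hP1 : ‖(N * 𝒟) s t‖ ≤ 3 / 2 * δ :=
      (klcr_mul_entry_le N 𝒟 hδ t (fun k => h𝒟 k t) s).trans (mul_le_mul_of_nonneg_right hNn hδ)
    have hwND : ‖(wC ᵥ* (N * 𝒟)) t‖ ≤ W * (3 / 2 * δ) := by
      refine (klcr_vecMul_entry_le wC (N * 𝒟) t (fun q =>
        (klcr_mul_entry_le N 𝒟 hδ t (fun k => h𝒟 k t) q).trans (mul_le_mul_of_nonneg_right hNn hδ))).trans (le_of_eq ?_)
      rw [hwsum]
    have hkey : ‖d‖⁻¹ * (u * W) ≤ 2 := by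
      rw [inv_mul_le_iff₀ hd_pos]; nlinarith [hd_norm, mul_nonneg hu hW]
    have hkey1 : u * W / (1 + u * W) ≤ 1 := by
      rw [div_le_one (by nlinarith [mul_nonneg hu hW])]; linarith
    have hP2 : ‖d⁻¹ * (a s * (wC ᵥ* (N * 𝒟)) t)‖ ≤ 9 / 2 * δ := by
      rw [norm_mul, norm_mul, norm_inv]
      calc ‖d‖⁻¹ * (‖a s‖ * ‖(wC ᵥ* (N * 𝒟)) t‖) ≤ ‖d‖⁻¹ * ((u * (3 / 2)) * (W * (3 / 2 * δ))) :=
            mul_le_mul_of_nonneg_left (mul_le_mul (ha_bound s) hwND (norm_nonneg _) (by positivity))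
              (inv_nonneg.mpr (norm_nonneg _))
        _ = (‖d‖⁻¹ * (u * W)) * (9 / 4 * δ) := by ring
        _ ≤ 2 * (9 / 4 * δ) := mul_le_mul_of_nonneg_right hkey (by positivity)
        _ = 9 / 2 * δ := by ring
    -- the s-wave piece against `cascadeStep W u = u / (1 + W u)`
    have hcas : (cascadeStep W u : ℝ) = u / (1 + u * W) := by rw [cascadeStep]; ring_nf
    have hP3 : ‖(u : ℂ) / d * m s - ((cascadeStep W u : ℝ) : ℂ)‖ ≤ 6 * δ := by
      have h1uW : 0 < 1 + u * W := by nlinarith [mul_nonneg hu hW]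
      set c : ℂ := ((1 + u * W : ℝ) : ℂ) with hc_def
      have hc_norm : ‖c‖ = 1 + u * W := by rw [hc_def, Complex.norm_real, Real.norm_eq_abs, abs_of_nonneg h1uW.le]
      have hc_ne : c ≠ 0 := by rw [← norm_pos_iff, hc_norm]; exact h1uW
      have hcasC : ((cascadeStep W u : ℝ) : ℂ) = (u : ℂ) / c := by rw [hcas, Complex.ofReal_div]
      rw [hcasC]
      have h2 : (u : ℂ) / d - (u : ℂ) / c = (u : ℂ) * (c - d) / (d * c) := by
        rw [div_sub_div _ _ hd_ne hc_ne]; ring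
      have hsplit : (u : ℂ) / d * m s - (u : ℂ) / c = (u : ℂ) / d * (m s - 1) + (u : ℂ) * (c - d) / (d * c) := by
        rw [← h2]; ring
      rw [hsplit]
      have hcd : ‖c - d‖ ≤ u * (W * (3 / 2 * (W * δ))) := by
        have : c - d = -((u : ℂ) * ∑ s, wC s * (m s - 1)) := by
          rw [hd_split, hc_def]; push_cast; ring
        rw [this, norm_neg, norm_mul, Complex.norm_real, Real.norm_eq_abs, abs_of_nonneg hu]
        exact mul_le_mul_of_nonneg_left hwm hu
      have h3δ : (0 : ℝ) ≤ 3 * δ := by linarith [hδ]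
      have hA : ‖(u : ℂ) / d * (m s - 1)‖ ≤ 3 * δ := by
        rw [norm_mul, norm_div, Complex.norm_real, Real.norm_eq_abs, abs_of_nonneg hu, div_mul_eq_mul_div,
          div_le_iff₀ hd_pos]
        have h3 : 3 * δ * (1 + u * W / 2) ≤ 3 * δ * ‖d‖ := mul_le_mul_of_nonneg_left hd_norm h3δ
        have h4 : u * (3 / 2 * (W * δ)) ≤ 3 * δ * (1 + u * W / 2) := by
          have : 3 * δ * (1 + u * W / 2) - u * (3 / 2 * (W * δ)) = 3 * δ := by ring
          linarith
        exact (mul_le_mul_of_nonneg_left (hm1 s) hu).trans (h4.trans h3)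
      have hB : ‖(u : ℂ) * (c - d) / (d * c)‖ ≤ 3 * δ := by
        rw [norm_div, norm_mul, norm_mul, Complex.norm_real, Real.norm_eq_abs, abs_of_nonneg hu, hc_norm,
          div_le_iff₀ (mul_pos hd_pos h1uW)]
        have hprod : 3 * δ * ((1 + u * W / 2) * (1 + u * W)) ≤ 3 * δ * (‖d‖ * (1 + u * W)) :=
          mul_le_mul_of_nonneg_left (mul_le_mul_of_nonneg_right hd_norm h1uW.le) h3δ
        have h5 : u * (u * (W * (3 / 2 * (W * δ)))) ≤ 3 * δ * ((1 + u * W / 2) * (1 + u * W)) := by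
          have : 3 * δ * ((1 + u * W / 2) * (1 + u * W)) - u * (u * (W * (3 / 2 * (W * δ)))) =
              3 * δ + 9 / 2 * (u * W * δ) := by ring
          have hnn : 0 ≤ u * W * δ := mul_nonneg (mul_nonneg hu hW) hδ
          linarith
        exact (mul_le_mul_of_nonneg_left hcd hu).trans (h5.trans hprod)
      calc ‖(u : ℂ) / d * (m s - 1) + (u : ℂ) * (c - d) / (d * c)‖
          ≤ ‖(u : ℂ) / d * (m s - 1)‖ + ‖(u : ℂ) * (c - d) / (d * c)‖ := norm_add_le _ _
        _ ≤ 3 * δ + 3 * δ := add_le_add hA hB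
        _ = 6 * δ := by ring
    rw [hentry]
    have hre : (u : ℂ) / d * m s + ((N * 𝒟) s t - d⁻¹ * (a s * (wC ᵥ* (N * 𝒟)) t)) - ((cascadeStep W u : ℝ) : ℂ) =
        ((u : ℂ) / d * m s - ((cascadeStep W u : ℝ) : ℂ)) + ((N * 𝒟) s t - d⁻¹ * (a s * (wC ᵥ* (N * 𝒟)) t)) := by ring
    calc ‖(u : ℂ) / d * m s + ((N * 𝒟) s t - d⁻¹ * (a s * (wC ᵥ* (N * 𝒟)) t)) - ((cascadeStep W u : ℝ) : ℂ)‖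
        = ‖((u : ℂ) / d * m s - ((cascadeStep W u : ℝ) : ℂ)) + ((N * 𝒟) s t - d⁻¹ * (a s * (wC ᵥ* (N * 𝒟)) t))‖ := by
          rw [hre]
      _ ≤ ‖(u : ℂ) / d * m s - ((cascadeStep W u : ℝ) : ℂ)‖ + ‖(N * 𝒟) s t - d⁻¹ * (a s * (wC ᵥ* (N * 𝒟)) t)‖ :=
          norm_add_le _ _
      _ ≤ 6 * δ + (3 / 2 * δ + 9 / 2 * δ) := add_le_add hP3 ((norm_sub_le _ _).trans (add_le_add hP1 hP2))
      _ = 12 * δ := by ring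

end Summit.HubbardSuperconductivity.HubbardSuperconductivity.Theorems.KLProgrammeCooperResummation

end
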